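import Summits.ResolutionOfSingularities.ResolutionOfSingularities.Theorems.FrobeniusLadderFInjectiveMacaulayficationBadMaximalPoints
import HarnessLib

/-!
# R3′ in the planner's `MapsTo`/`InjOn` form (crux `FInjectiveMacaulayfication`, hole-#3 interfaces v3)

[OURS · L1 W4.5a] Support file for crux stmt-ResolutionOfSingularities-15315.  `HoleThreeInterfaces3.MaxBadDropsUnderStrongPlus p` asks,
for a STRONG⁺ step `π : X₂ ⟶ X₁` at `η` (iso over `(closure {η})ᶜ`, no NON-CLOSED bad point over `closure {η}`), that `π.base` map the
generization-maximal non-closed bad points of `X₂` INTO those of `X₁` minus `η`, INJECTIVELY.  `mapsTo_injOn_of_strongPlusStep` proves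
this for arbitrary predicates `Good₁`, `Good₂` transported along `π` over the iso-locus (the counting form is
`BadMaximalPoints.card_maximal_nonclosed_lt_of_strongPlusStep`, p486389); the planner's Prop follows by instantiating `Goodᵢ` with the
Frobenius clause (`IsoLocusTransport.fClause_iff_of_isIso_morphismRestrict`).  No definition is declared; AI-written, weaker than
expert review; no statement of [claim: Hironaka2017] is used. [folklore]
-/

-- single-problem summit: the doubled namespace component `ResolutionOfSingularities` is forced
set_option linter.dupNamespace false

noncomputable section

open CategoryTheory AlgebraicGeometry TopologicalSpace Topology
open Summit.ResolutionOfSingularities.ResolutionOfSingularities.Theorems.FInjectiveMacaulayfication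

namespace Summit.ResolutionOfSingularities.ResolutionOfSingularities.Theorems.FInjectiveMacaulayfication.StrongPlusMapsTo

/-- **R3′ (`MapsTo`/`InjOn` form).**  With `M(X) = {ξ | ξ non-closed, ¬ Good ξ, every proper generization of ξ is Good}`: under a STRONG⁺ step,
`π.base` maps `M(X₂)` into `M(X₁) ∖ {η}` and is injective on `M(X₂)`. [folklore] -/
theorem mapsTo_injOn_of_strongPlusStep {X₂ X₁ : Scheme.{0}} (π : X₂ ⟶ X₁) (η : X₁) (U : X₁.Opens)
    (hU : (U : Set X₁) = (closure ({η} : Set X₁))ᶜ) [IsIso (π ∣_ U)] (Good₁ : X₁ → Prop) (Good₂ : X₂ → Prop)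
    (htrans : ∀ x : X₂, π.base x ∈ U → (Good₂ x ↔ Good₁ (π.base x)))
    (hgood : ∀ x : X₂, π.base x ∈ closure ({η} : Set X₁) → ¬ IsClosed ({x} : Set X₂) → Good₂ x) :
    Set.MapsTo π.base {ξ : X₂ | ¬ IsClosed ({ξ} : Set X₂) ∧ ¬ Good₂ ξ ∧ ∀ y : X₂, y ⤳ ξ → y ≠ ξ → Good₂ y}
        ({ξ : X₁ | ¬ IsClosed ({ξ} : Set X₁) ∧ ¬ Good₁ ξ ∧ ∀ y : X₁, y ⤳ ξ → y ≠ ξ → Good₁ y} \ {η}) ∧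
      Set.InjOn π.base {ξ : X₂ | ¬ IsClosed ({ξ} : Set X₂) ∧ ¬ Good₂ ξ ∧ ∀ y : X₂, y ⤳ ξ → y ≠ ξ → Good₂ y} := by
  have hoverU : ∀ x : X₂, ¬ IsClosed ({x} : Set X₂) → ¬ Good₂ x → π.base x ∈ U := fun x hxc hx => by
    rw [← SetLike.mem_coe, hU, Set.mem_compl_iff]
    exact fun h => hx (hgood x h hxc)
  have hgenU : ∀ (y y' : X₁), y ⤳ y' → y' ∈ U → y ∈ U := fun y y' hsp hy' => by
    rw [← SetLike.mem_coe, hU, Set.mem_compl_iff] at hy' ⊢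
    exact fun hy => hy' (isClosed_closure.closure_subset_iff.mpr (Set.singleton_subset_iff.mpr hy)
      (specializes_iff_mem_closure.mp hsp))
  refine ⟨?_, ?_⟩
  · rintro x ⟨hxc, hxb, hxmax⟩
    have hxU := hoverU x hxc hxb
    refine ⟨⟨fun hc => hxc (BadMaximalPoints.isClosed_singleton_of_isClosed_base π U x hxU hc),
      fun h => hxb ((htrans x hxU).mpr h), fun y hsp hne => ?_⟩, ?_⟩
    · -- a bad proper generization of `π x` lifts to a bad proper generization of `x`
      by_contra hy
      have hyU : y ∈ U := hgenU y _ hsp hxU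
      obtain ⟨x', hx'⟩ := BadMaximalPoints.exists_base_eq_of_isIso_morphismRestrict π U y hyU
      have hx'U : π.base x' ∈ U := hx' ▸ hyU
      have hbad' : ¬ Good₂ x' := fun h => hy (hx' ▸ (htrans x' hx'U).mp h)
      have hsp' : x' ⤳ x :=
        (BadMaximalPoints.specializes_iff_of_isIso_morphismRestrict π U x' x hx'U hxU).mpr (hx' ▸ hsp)
      have hne' : x' ≠ x := fun h => hne (by rw [← hx', h])
      exact hbad' (hxmax x' hsp' hne')
    · -- `π x ≠ η`
      intro h
      have hU' := hxU
      rw [Set.mem_singleton_iff.mp h, ← SetLike.mem_coe, hU, Set.mem_compl_iff] at hU'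
      exact hU' (subset_closure (Set.mem_singleton η))
  · rintro x ⟨hxc, hxb, -⟩ x' ⟨hxc', hxb', -⟩ h
    exact BadMaximalPoints.eq_of_base_eq_of_isIso_morphismRestrict π U x x' (hoverU x hxc hxb) (hoverU x' hxc' hxb') h

end Summit.ResolutionOfSingularities.ResolutionOfSingularities.Theorems.FInjectiveMacaulayfication.StrongPlusMapsTo

end
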